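import Literature.MathematicalPhysics.QuantumLattice.GroundStateReflectionPositivityHeisenberg
import Literature.MathematicalPhysics.QuantumLattice.HeisenbergOrderTranslationProofs
import Literature.MathematicalPhysics.QuantumLattice.HeisenbergOrderNeelInfrared
import Literature.MathematicalPhysics.QuantumLattice.HeisenbergOrderNeelTwoSumRule
import HarnessLib

/-!
# Reflection-positivity blocks of the ground-state two-point function (Heisenberg antiferromagnet)

Literature: Dyson–Lieb–Simon, *J. Stat. Phys.* **18** (1978) 335, Lemma 4.1 and Theorem 4.2
(reflection positivity of the antiferromagnet after the sublattice rotation) [cite: DLS1978, Theorem 4.2];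
Kennedy–Lieb–Shastry, *J. Stat. Phys.* **53** (1988) 1019, eqs. (20)–(25) (the same at `T = 0`,
for the ground state of the even torus) and p. 1021 (the two-point function `g_q`)
[cite: KLS1988JSP, eqs. (20)–(25)].

An addendum to `GroundStateReflectionPositivityHeisenberg.lean` (the Gram form
`heisenbergTorus_groundStateFunctional_rpGram_posSemidef`) and `HeisenbergOrderNeelProofs.lean`
(the two-point function `heisGroundCorr`, the structure factor `heisStructureFactor`, the bond
correlation `heisBondCorr`), written so that finite-volume certificates can be stated over the
translation-reduced correlation function `c(r) = G(0, r)`: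

* translation reduction (T): `G(x + v, y + v) = G(x, y)` (`heisGroundCorr_add_right`), hence
  `G(x, y) = c(y - x)`, `c(-r) = c(r)`, `c(r ∘ s) = c(r)` for a permutation `s` of the axes;
* the structure factor and the bond correlation through `c`:
  `ĝ_q = Σ_r cos(q·r) c(r)` (`heisStructureFactor_eq_sum_zero_left`),
  `ε = d⁻¹ Σᵢ c(eᵢ)` (`heisBondCorr_eq_sum_zero_left`);
* **the reflection-positivity Hankel blocks** (R): on the two-dimensional torus of even side `2k`,
  for every transverse momentum `j ∈ ℤ/2kℤ` and every real `w : Fin k → ℝ`,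
  `0 ≤ Σ_{i,i'} w_i w_{i'} Σ_t cos(2π j t/2k) · (−c(i + i' + 1, t))`
  (`heis_rpHankelBlock_nonneg`): the Gram matrix `[−ω(Sᶻ_x Sᶻ_{θy})]_{x,y ∈ left half} ⪰ 0` of the
  one-letter `Sᶻ` words (DLS Theorem 4.2 / KLS eq. (25), in the tree as
  `heisenbergTorus_groundStateFunctional_rpGram_posSemidef`), tested against the real vectors
  `w_i cos(2πjs/2k)` and `w_i sin(2πjs/2k)` and summed, then reduced by translation invariance in
  the transverse direction (`x − θy = (i + i' + 1, s − s')` for the reflection between the rows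
  `−1 | 0`);
* bookkeeping for explicit tori: `Σ_{r ∈ (ℤ/L)²} F(r) = Σ_{a<L} Σ_{b<L} F(a, b)`
  (`sum_torusSite_two_eq_sum_range`) and `cos(q·r) = cos(2π (Σᵢ qᵢ rᵢ mod L)/L)`
  (`cos_torusPhase_eq_cos_val`); the natural-number API `c(a,b) = heisRedCorr2 L n a b`,
  `cosNat L m = cos(2πm/L)` in which a certificate row only expands `Finset.sum_range_succ` and reads
  a table of `L` cosines (`heisStructureFactor_two_eq_sum_range`, `heisBondCorr_two_eq`,
  `torusCosSum_two_natCast`, `heisRedCorr2_swap`/`_neg_mod`/`_zero_zero`/`_abs_le`,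
  `heis_rpHankelBlock_range`);
* the PAIRED blocks `j`, `k - j` (`cos(2π(k-j)t/2k) = (-1)^t cos(2πjt/2k)`): when the odd-`t` cosines
  are `σ·s(t)` with `σ` irrational (`√2/2` on the `8`-torus, `√3/2` on the `12`-torus) the rational
  cuts `Ev ± ρ·Od ≥ 0`, `0 ≤ ρ ≤ σ` rational (`heis_rpHankelPair_range`); and both kinds of block
  collected along the `2k - 1` anti-diagonals `m = i + i' + 1` (`heis_rpHankelBlock_collected`,
  `heis_rpHankelPair_collected`), so that a row expands `2k - 1` inner sums instead of `k²`.

Everything is proved; no named facts. (Written for the pub-hubbard certificate ladder — ladder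
R1–R4 with certified numbers; no claim on H/H₀: these blocks, the `T = 0` infrared bound
`heis_infraredBound` and an energy window are the hypotheses of the linear-programming lower bounds
on the finite-volume Néel order parameter in `Summits/HubbardSuperconductivity/HubbardLadder/`.)
-/

noncomputable section

open Matrix Finset Literature.Probability.LatticeModels
open scoped ComplexOrder

namespace Literature.MathematicalPhysics.QuantumLattice

variable {d : ℕ}

/-! ### (T) Translation reduction of the two-point function -/

section Translation

/-- **Translation invariance of the ground-state two-point function**:
`G(x + v, y + v) = G(x, y)` (the relabelling `x ↦ x + v` fixes `H_L` and the tracial ground state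
is invariant under symmetries of `H_L`). [cite: KLS1988JSP, p. 1021] -/
theorem heisGroundCorr_add_right (α : Fin 3) (L n : ℕ) (x y v : TorusSite d L) :
    heisGroundCorr α L n (x + v) (y + v) = heisGroundCorr α L n x y := by
  rcases Nat.eq_zero_or_pos L with rfl | hL
  · simp
  haveI : NeZero L := ⟨hL.ne'⟩
  rw [heisGroundCorr_of_neZero, heisGroundCorr_of_neZero]
  have hx : siteSpin n (x + v) α =
      (siteSpin n x α : Op (TorusSite d L) (n + 1)).submatrix
        (fun σ => σ ∘ Equiv.addRight v) (fun σ => σ ∘ Equiv.addRight v) :=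
    (siteSpin_submatrix_comp n (Equiv.addRight v) x α).symm
  have hy : siteSpin n (y + v) α =
      (siteSpin n y α : Op (TorusSite d L) (n + 1)).submatrix
        (fun σ => σ ∘ Equiv.addRight v) (fun σ => σ ∘ Equiv.addRight v) :=
    (siteSpin_submatrix_comp n (Equiv.addRight v) y α).symm
  rw [hx, hy, ← Matrix.submatrix_mul _ _ _ _ _ (bijective_comp_equiv (q := n + 1) _),
    groundStateFunctional_heisenbergTorus_submatrix_comp_addRight]

/-- The two-point function through the reduced correlation function `c(r) = G(0, r)`:
`G(x, y) = c(y - x)`. [cite: KLS1988JSP, p. 1021] -/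
theorem heisGroundCorr_eq_zero_left (α : Fin 3) (L n : ℕ) (x y : TorusSite d L) :
    heisGroundCorr α L n x y = heisGroundCorr α L n 0 (y - x) := by
  rw [← heisGroundCorr_add_right α L n x y (-x), add_neg_cancel, ← sub_eq_add_neg]

/-- Inversion symmetry of the reduced correlation function: `c(-r) = c(r)`. [folklore] -/
private theorem heisGroundCorr_zero_neg (α : Fin 3) (L n : ℕ) (r : TorusSite d L) :
    heisGroundCorr α L n 0 (-r) = heisGroundCorr α L n 0 r := by
  rw [heisGroundCorr_symm α L n 0 (-r), heisGroundCorr_eq_zero_left α L n (-r) 0, zero_sub, neg_neg]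

/-- Axis-permutation symmetry of the reduced correlation function: `c(r ∘ s) = c(r)`. [folklore] -/
private theorem heisGroundCorr_zero_comp_perm (L : ℕ) [NeZero L] (n : ℕ) (s : Equiv.Perm (Fin d))
    (α : Fin 3) (r : TorusSite d L) :
    heisGroundCorr α L n 0 (r ∘ s) = heisGroundCorr α L n 0 r :=
  heisGroundCorr_comp_perm (L := L) (n := n) s α 0 r

/-- `Σ_x Σ_y F(x - y) = |G| Σ_r F(r)` on a finite abelian group. [folklore] -/
private theorem sum_sum_sub_eq_card_mul {G : Type*} [AddCommGroup G] [Fintype G] (F : G → ℝ) :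
    ∑ x, ∑ y, F (x - y) = (Fintype.card G : ℝ) * ∑ r, F r := by
  have h : ∀ x : G, ∑ y, F (x - y) = ∑ r, F r := fun x =>
    Fintype.sum_equiv (Equiv.subLeft x) _ _ fun y => rfl
  simp only [h, sum_const, card_univ, nsmul_eq_mul]

/-- `|(ℤ/Lℤ)^d| = L^d`. [folklore] -/
private theorem card_torusSite_cast (L : ℕ) [NeZero L] :
    (Fintype.card (TorusSite d L) : ℝ) = (L : ℝ) ^ d := by
  rw [Fintype.card_fun, ZMod.card, Fintype.card_fin]
  push_cast
  ring

/-- **The structure factor through the reduced correlation function**: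
`ĝ_q = Σ_r cos(q·r) c(r)`. [cite: KLS1988JSP, p. 1021] -/
theorem heisStructureFactor_eq_sum_zero_left (α : Fin 3) (L : ℕ) [NeZero L] (n : ℕ)
    (q : TorusSite d L) :
    heisStructureFactor α L n q = ∑ r, Real.cos (torusPhase L q r) * heisGroundCorr α L n 0 r := by
  rw [heisStructureFactor_of_neZero]
  have h : ∀ x y : TorusSite d L, Real.cos (torusPhase L q (x - y)) * heisGroundCorr α L n x y =
      (fun r => Real.cos (torusPhase L q r) * heisGroundCorr α L n 0 r) (x - y) := fun x y => by
    simp only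
    rw [heisGroundCorr_symm, heisGroundCorr_eq_zero_left]
  have hs := sum_sum_sub_eq_card_mul (G := TorusSite d L)
    (fun r => Real.cos (torusPhase L q r) * heisGroundCorr α L n 0 r)
  simp only [← h, card_torusSite_cast] at hs
  rw [hs]
  have hN : (L : ℝ) ^ d ≠ 0 := pow_ne_zero _ (by exact_mod_cast NeZero.ne L)
  exact mul_div_cancel_left₀ _ hN

/-- **The bond correlation through the reduced correlation function**: `ε = d⁻¹ Σᵢ c(eᵢ)`.
[cite: KLS1988JSP, eq. (3)] -/
theorem heisBondCorr_eq_sum_zero_left (α : Fin 3) (L : ℕ) [NeZero L] (n : ℕ) :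
    heisBondCorr (d := d) α L n = (∑ i : Fin d, heisGroundCorr α L n 0 (Pi.single i 1)) / d := by
  have h0 : heisBondCorr (d := d) α L n =
      (∑ x : TorusSite d L, ∑ i : Fin d, heisGroundCorr α L n x (x + Pi.single i 1)) /
        ((d : ℝ) * (L : ℝ) ^ d) := by
    simp [heisBondCorr, NeZero.ne L]
  have h1 : ∀ (x : TorusSite d L) (i : Fin d), heisGroundCorr α L n x (x + Pi.single i 1) =
      heisGroundCorr α L n 0 (Pi.single i 1) := fun x i => by
    rw [heisGroundCorr_eq_zero_left, add_sub_cancel_left]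
  simp_rw [h0, h1, sum_const, card_univ, nsmul_eq_mul, card_torusSite_cast]
  have hN : (L : ℝ) ^ d ≠ 0 := pow_ne_zero _ (by exact_mod_cast NeZero.ne L)
  rw [mul_comm (d : ℝ), ← div_div, mul_div_cancel_left₀ _ hN]

end Translation

/-! ### Bookkeeping for explicit tori -/

section Bookkeeping

/-- `Σ_{x ∈ ℤ/Lℤ} g(x) = Σ_{a<L} g(a)`. [folklore] -/
private theorem sum_zmod_eq_sum_range (L : ℕ) [NeZero L] (g : ZMod L → ℝ) :
    ∑ x : ZMod L, g x = ∑ a ∈ range L, g (a : ZMod L) := by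
  refine Finset.sum_nbij' (fun x : ZMod L => x.val) (fun a : ℕ => (a : ZMod L)) (fun x _ => ?_)
    (fun a _ => mem_univ _) (fun x _ => ZMod.natCast_zmod_val x) (fun a ha => ?_) (fun x _ => ?_)
  · exact mem_range.2 (ZMod.val_lt x)
  · exact ZMod.val_cast_of_lt (mem_range.1 ha)
  · rw [ZMod.natCast_zmod_val]

/-- `Σ_{r ∈ (ℤ/Lℤ)²} F(r) = Σ_{a<L} Σ_{b<L} F(a, b)`. [folklore] -/
private theorem sum_torusSite_two_eq_sum_range (L : ℕ) [NeZero L] (F : TorusSite 2 L → ℝ) :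
    ∑ r, F r = ∑ a ∈ range L, ∑ b ∈ range L, F ![(a : ZMod L), (b : ZMod L)] := by
  rw [← Fintype.sum_equiv (piFinTwoEquiv fun _ => ZMod L).symm (fun ab => F ![ab.1, ab.2]) F
    (fun ab => rfl), Fintype.sum_prod_type, sum_zmod_eq_sum_range]
  exact sum_congr rfl fun a _ => sum_zmod_eq_sum_range L _

/-- `cos(q·r) = cos(2π ((Σᵢ qᵢ rᵢ) mod L)/L)`: the phase only matters through the residue of
`Σᵢ qᵢ rᵢ` in `ℤ/Lℤ`. [folklore] -/
private theorem cos_torusPhase_eq_cos_val (L : ℕ) [NeZero L] (q r : TorusSite d L) :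
    Real.cos (torusPhase L q r) =
      Real.cos (2 * Real.pi * (((∑ i, q i * r i : ZMod L)).val : ℝ) / L) := by
  set m : ℕ := ∑ i, (q i).val * (r i).val with hm
  have hcast : ((m : ℕ) : ZMod L) = ∑ i, q i * r i := by
    rw [hm]; push_cast; simp only [ZMod.natCast_val, ZMod.cast_id', id_eq]
  have hval : (∑ i, q i * r i : ZMod L).val = m % L := by rw [← hcast, ZMod.val_natCast]
  have hL : (L : ℝ) ≠ 0 := by exact_mod_cast NeZero.ne L
  have hphase : torusPhase L q r = 2 * Real.pi * (m : ℝ) / L := by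
    unfold torusPhase; rw [hm]; push_cast; rfl
  rw [hval, hphase]
  conv_lhs => rw [← Nat.div_add_mod m L]
  rw [show 2 * Real.pi * ((L * (m / L) + m % L : ℕ) : ℝ) / L =
      2 * Real.pi * ((m % L : ℕ) : ℝ) / L + ((m / L : ℕ) : ℝ) * (2 * Real.pi) by
    push_cast; field_simp; ring]
  exact Real.cos_add_nat_mul_two_pi _ _

end Bookkeeping

/-! ### (R) The reflection-positivity Hankel blocks of the `Sᶻ` words on the two-dimensional torus -/

section RPBlocks

variable (k : ℕ) [NeZero (2 * k)] (n : ℕ)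

/-- The site `(i, s)` of the left half `{x₀ ∈ {0, …, k-1}}` of the torus `(ℤ/2kℤ)²`
(reflection between the rows `-1 | 0` in direction `0`). [cite: DLS1978, §4] -/
private def rpSite (p : Fin k × ZMod (2 * k)) : TorusSite 2 (2 * k) := ![((p.1 : ℕ) : ZMod (2 * k)), p.2]

/-- `(i, s)` lies in the left half `torusLeftHalf (2k) 0 (-1) = {x : x₀ ∈ {0, …, k-1}}`. [folklore] -/
private theorem rpSite_mem (p : Fin k × ZMod (2 * k)) :
    rpSite k p ∈ torusLeftHalf (2 * k) (0 : Fin 2) (-1) := by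
  simp only [torusLeftHalf, mem_filter, mem_univ, true_and, rpSite, neg_add_cancel, sub_zero,
    cons_val_zero]
  rw [ZMod.val_cast_of_lt (by have := p.1.isLt; omega)]
  have := p.1.isLt
  omega

/-- The one-letter word `Sᶻ_{(i,s)}`. [cite: DLS1978, §4] -/
private def rpZWord (p : Fin k × ZMod (2 * k)) : List (torusLeftHalf (2 * k) (0 : Fin 2) (-1) × SpinLetter) :=
  [(⟨rpSite k p, rpSite_mem k p⟩, SpinLetter.zee)]

/-- The displacement `x_a − θx_b = (i + i' + 1, s − s')` between a left site and a reflected left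
site, up to sign. [folklore] -/
private def rpDiff (a b : Fin k × ZMod (2 * k)) : TorusSite 2 (2 * k) :=
  ![((a.1 : ℕ) : ZMod (2 * k)) + ((b.1 : ℕ) : ZMod (2 * k)) + 1, a.2 - b.2]

omit [NeZero (2 * k)] in
/-- `θx_b − x_a = −(i + i' + 1, s − s')` for the reflection `θ : x₀ ↦ -1 - x₀`. [folklore] -/
private theorem reflect_rpSite_sub (a b : Fin k × ZMod (2 * k)) :
    Torus.reflectBetweenSites (0 : Fin 2) (-1 : ZMod (2 * k)) (rpSite k b) - rpSite k a =
      -rpDiff k a b := by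
  ext i
  fin_cases i
  · simp [Torus.reflectBetweenSites_apply, rpSite, rpDiff]; ring
  · simp [Torus.reflectBetweenSites_apply, rpSite, rpDiff]

/-- The real part of a complex quadratic form at a real vector. [folklore] -/
private theorem re_star_dotProduct_mulVec_ofReal {κ : Type*} [Fintype κ] (M : Matrix κ κ ℂ) (u : κ → ℝ) :
    (star (fun a => (u a : ℂ)) ⬝ᵥ (M *ᵥ fun a => (u a : ℂ))).re =
      ∑ a, ∑ b, u a * u b * (M a b).re := by
  simp only [dotProduct, mulVec, Pi.star_apply, Complex.star_def, Complex.conj_ofReal,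
    Complex.re_sum, mul_sum, Complex.mul_re, Complex.ofReal_re, Complex.ofReal_im, zero_mul,
    sub_zero, mul_zero]
  exact sum_congr rfl fun a _ => sum_congr rfl fun b _ => by ring

/-- **Reflection positivity of the `Sᶻ` two-point function, real-space form**: for every real
`u` on the left half `{0, …, k-1} × ℤ/2kℤ`,
`0 ≤ Σ_{a,b} u_a u_b (−c(i_a + i_b + 1, s_a − s_b))` — the Gram matrix
`[−ω(Sᶻ_{x_a} Sᶻ_{θx_b})]_{ab} ⪰ 0` of DLS Theorem 4.2 / KLS eq. (25) at a real vector, with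
`G(x_a, θx_b) = c(θx_b − x_a) = c(i_a + i_b + 1, s_a − s_b)` by (T) and inversion.
[cite: DLS1978, Theorem 4.2] [cite: KLS1988JSP, eq. (25)] -/
theorem heis_rpGramZ_nonneg (u : Fin k × ZMod (2 * k) → ℝ) :
    0 ≤ ∑ a, ∑ b, u a * u b * -heisGroundCorr 0 (2 * k) n 0 (rpDiff k a b) := by
  have hM := heisenbergTorus_groundStateFunctional_rpGram_posSemidef (d := 2) (2 * k) (even_two_mul k)
    (0 : Fin 2) (-1) n (J := 1) one_pos (rpZWord k)
  have h := (Complex.nonneg_iff.mp (hM.dotProduct_mulVec_nonneg fun a => (u a : ℂ))).1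
  rw [re_star_dotProduct_mulVec_ofReal] at h
  refine h.trans_eq (sum_congr rfl fun a _ => sum_congr rfl fun b _ => ?_)
  congr 1
  have hword : ∀ p, rpWord (2 * k) (0 : Fin 2) (-1) n (rpZWord k p) = siteSpin n (rpSite k p) 2 := fun p => by
    simp [rpWord, rpZWord, SpinLetter.mat, siteSpin, spinVec_two]
  have hrefl : ∀ p, rpReflWord (2 * k) (0 : Fin 2) (-1) n (rpZWord k p) =
      siteSpin n (Torus.reflectBetweenSites (0 : Fin 2) (-1 : ZMod (2 * k)) (rpSite k p)) 2 := fun p => by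
    simp [rpReflWord, rpZWord, SpinLetter.mat, SpinLetter.bar, siteSpin, spinVec_two]
  rw [Matrix.of_apply, hword, hrefl, rpZWord, List.length_singleton, pow_one, neg_one_mul,
    Complex.neg_re, ← heisGroundCorr_of_neZero, heisGroundCorr_eq_zero_comp 2,
    heisGroundCorr_eq_zero_left, reflect_rpSite_sub, heisGroundCorr_zero_neg]

/-- **The reflection-positivity Hankel blocks.** On the torus `(ℤ/2kℤ)²`, for every transverse
momentum `j` and every real `w : Fin k → ℝ`,
`0 ≤ Σ_{i,i'<k} w_i w_{i'} Σ_t cos(q_j · (0,t)) (−c(i + i' + 1, t))`, `q_j = (0, j)`: the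
real-space form at the vectors `w_i cos(q_j·(0,s))` and `w_i sin(q_j·(0,s))`, summed
(`cos(q·(x−y)) = cos cos + sin sin`) and reduced by the transverse translations. For fixed `j`
this says that the `k × k` Hankel matrix `[T_j(i + i' + 1)]`, `T_j(m) = −Σ_t cos(2πjt/2k) c(m,t)`,
is positive semidefinite. [cite: DLS1978, Theorem 4.2] [cite: KLS1988JSP, eqs. (20)–(25)] -/
theorem heis_rpHankelBlock_nonneg (j : ZMod (2 * k)) (w : Fin k → ℝ) :
    0 ≤ ∑ i : Fin k, ∑ i' : Fin k, w i * w i' *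
        ∑ t : ZMod (2 * k), Real.cos (torusPhase (2 * k) ![0, j] ![0, t]) *
          -heisGroundCorr 0 (2 * k) n 0
            ![((i : ℕ) : ZMod (2 * k)) + ((i' : ℕ) : ZMod (2 * k)) + 1, t] := by
  set q : TorusSite 2 (2 * k) := ![0, j] with hq
  -- the summand as a function of the two row indices and the transverse displacement
  set g : Fin k → Fin k → ZMod (2 * k) → ℝ := fun i i' t =>
    Real.cos (torusPhase (2 * k) q ![0, t]) *
      -heisGroundCorr 0 (2 * k) n 0 ![((i : ℕ) : ZMod (2 * k)) + ((i' : ℕ) : ZMod (2 * k)) + 1, t]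
    with hg
  have h1 := heis_rpGramZ_nonneg k n fun p => w p.1 * Real.cos (torusPhase (2 * k) q ![0, p.2])
  have h2 := heis_rpGramZ_nonneg k n fun p => w p.1 * Real.sin (torusPhase (2 * k) q ![0, p.2])
  have hsum : ∀ a b : Fin k × ZMod (2 * k),
      w a.1 * Real.cos (torusPhase (2 * k) q ![0, a.2]) * (w b.1 * Real.cos (torusPhase (2 * k) q ![0, b.2])) *
          -heisGroundCorr 0 (2 * k) n 0 (rpDiff k a b) +
        w a.1 * Real.sin (torusPhase (2 * k) q ![0, a.2]) * (w b.1 * Real.sin (torusPhase (2 * k) q ![0, b.2])) *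
          -heisGroundCorr 0 (2 * k) n 0 (rpDiff k a b) =
      w a.1 * w b.1 * g a.1 b.1 (a.2 - b.2) := fun a b => by
    have hc := cos_torusPhase_sub (2 * k) q ![0, a.2] ![0, b.2]
    have hv : (![0, a.2] : TorusSite 2 (2 * k)) - ![0, b.2] = ![0, a.2 - b.2] := by
      ext i; fin_cases i <;> simp
    rw [hv] at hc
    simp only [hg, rpDiff, hc]
    ring
  have h12 := add_nonneg h1 h2
  rw [← sum_add_distrib] at h12
  simp_rw [← sum_add_distrib, hsum] at h12
  -- reduce the transverse double sum by translation invariance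
  have hred : ∑ a : Fin k × ZMod (2 * k), ∑ b : Fin k × ZMod (2 * k), w a.1 * w b.1 * g a.1 b.1 (a.2 - b.2) =
      ((2 * k : ℕ) : ℝ) * ∑ i : Fin k, ∑ i' : Fin k, w i * w i' * ∑ t, g i i' t := by
    rw [Fintype.sum_prod_type]
    have hin : ∀ (i : Fin k) (s : ZMod (2 * k)),
        ∑ b : Fin k × ZMod (2 * k), w i * w b.1 * g i b.1 (s - b.2) =
          ∑ i' : Fin k, w i * w i' * ∑ t, g i i' t := fun i s => by
      rw [Fintype.sum_prod_type]
      refine sum_congr rfl fun i' _ => ?_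
      rw [mul_sum]
      exact Fintype.sum_equiv (Equiv.subLeft s) _ _ fun t => rfl
    simp only [hin, sum_const, card_univ, ZMod.card, nsmul_eq_mul, mul_sum]
  rw [hred] at h12
  have h2k : (0 : ℝ) < ((2 * k : ℕ) : ℝ) := by exact_mod_cast Nat.pos_of_ne_zero (NeZero.ne (2 * k))
  simpa only [hg] using (mul_nonneg_iff_of_pos_left h2k).mp h12

/-- `cos(q_j · (0, t)) = cos(2π (jt mod 2k)/2k)` for the transverse momentum `q_j = (0, j)`.
[folklore] -/
private theorem cos_torusPhase_transverse (j t : ZMod (2 * k)) :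
    Real.cos (torusPhase (2 * k) ![0, j] ![0, t]) =
      Real.cos (2 * Real.pi * (((j * t : ZMod (2 * k))).val : ℝ) / ((2 * k : ℕ) : ℝ)) := by
  rw [cos_torusPhase_eq_cos_val]
  simp [Fin.sum_univ_two]

end RPBlocks

/-! ### Natural-number bookkeeping on the two-dimensional torus `(ℤ/Lℤ)²`

For certificates on an explicit torus every sum is written over `a, b < L` and every momentum phase
through `cosNat L m = cos(2πm/L)` at a residue `m < L`, so that a row file only has to expand
`Finset.sum_range_succ` and read a table of `L` cosines. -/

section NatBookkeeping

/-- The reduced ground-state correlation function of the spin-`n/2` antiferromagnet on `(ℤ/Lℤ)²`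
at the displacement `(a, b)`: `c(a, b) = G((0,0), (a,b)) = Re ω(Sᶻ_0 Sᶻ_{(a,b)})`.
[cite: KLS1988JSP, p. 1021] -/
def heisRedCorr2 (L n a b : ℕ) : ℝ := heisGroundCorr 0 L n 0 ![(a : ZMod L), (b : ZMod L)]

/-- `cos(2πm/L)`. [folklore] -/
def cosNat (L m : ℕ) : ℝ := Real.cos (2 * Real.pi * (m : ℝ) / (L : ℝ))

/-- `c(0, 0) = S(S+1)/3 = ⟨(Sᶻ₀)²⟩` (the on-site value of the two-point function `g`). [cite: KLS1988JSP, eqs. (15)–(25)] -/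
theorem heisRedCorr2_zero_zero (L : ℕ) [NeZero L] (n : ℕ) :
    heisRedCorr2 L n 0 0 = (n : ℝ) / 2 * ((n : ℝ) / 2 + 1) / 3 := by
  rw [heisRedCorr2, ← heisGroundCorr_self L n (0 : TorusSite 2 L)]
  congr 1
  ext i; fin_cases i <;> simp

/-- `|c(a, b)| ≤ S²` (the two-point function `g` is bounded by the spin). [cite: KLS1988JSP, eqs. (15)–(25)] -/
theorem heisRedCorr2_abs_le (L n a b : ℕ) : |heisRedCorr2 L n a b| ≤ ((n : ℝ) / 2) ^ 2 :=
  heisGroundCorr_abs_le 0 L n _ _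

/-- Lattice symmetry of the two-point function `g`: `c(a, b) = c(b, a)`. [cite: KLS1988JSP, eqs. (15)–(25)] -/
theorem heisRedCorr2_swap (L : ℕ) [NeZero L] (n a b : ℕ) : heisRedCorr2 L n a b = heisRedCorr2 L n b a := by
  rw [heisRedCorr2, heisRedCorr2, ← heisGroundCorr_zero_comp_perm L n (Equiv.swap 0 1) 0]
  congr 1
  ext i; fin_cases i <;> simp

/-- Periodicity of the two-point function `g` on the torus: `c(a, b) = c(a mod L, b mod L)`. [cite: KLS1988JSP, eqs. (15)–(25)] -/
theorem heisRedCorr2_mod (L n a b : ℕ) : heisRedCorr2 L n a b = heisRedCorr2 L n (a % L) (b % L) := by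
  simp only [heisRedCorr2, ZMod.natCast_mod]

/-- Inversion symmetry of the two-point function `g`, in residues:
`c(a, b) = c((L - a mod L) mod L, (L - b mod L) mod L)`. [cite: KLS1988JSP, eqs. (15)–(25)] -/
theorem heisRedCorr2_neg_mod (L : ℕ) [NeZero L] (n a b : ℕ) :
    heisRedCorr2 L n a b = heisRedCorr2 L n ((L - a % L) % L) ((L - b % L) % L) := by
  rw [← heisRedCorr2_mod, heisRedCorr2, heisRedCorr2, ← heisGroundCorr_zero_neg]
  have hneg : ∀ a : ℕ, -((a : ℕ) : ZMod L) = ((L - a % L : ℕ) : ZMod L) := fun a => by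
    rw [Nat.cast_sub (Nat.mod_lt a (Nat.pos_of_ne_zero (NeZero.ne L))).le, ZMod.natCast_self,
      ZMod.natCast_mod, zero_sub]
  congr 1
  ext i; fin_cases i <;> simp [hneg]

/-- `Σᵢ cos qᵢ = E_q - d` at the momentum `q = 2π(q₁, q₂)/L`. [cite: KLS1988JSP, eqs. (15)–(25)] -/
theorem torusCosSum_two_natCast (L : ℕ) [NeZero L] (q₁ q₂ : ℕ) :
    torusCosSum L ![(q₁ : ZMod L), (q₂ : ZMod L)] = cosNat L (q₁ % L) + cosNat L (q₂ % L) := by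
  simp only [torusCosSum, Fin.sum_univ_two, latticeMomentum_apply, cons_val_zero, cons_val_one,
    ZMod.val_natCast, cosNat]

/-- **The structure factor as an explicit finite sum**:
`ĝ_{(q₁,q₂)} = Σ_{a,b<L} cos(2π((q₁a + q₂b) mod L)/L) c(a,b)`. [cite: KLS1988JSP, p. 1021] -/
theorem heisStructureFactor_two_eq_sum_range (L : ℕ) [NeZero L] (n q₁ q₂ : ℕ) :
    heisStructureFactor 0 L n ![(q₁ : ZMod L), (q₂ : ZMod L)] =
      ∑ a ∈ range L, ∑ b ∈ range L, cosNat L ((q₁ * a + q₂ * b) % L) * heisRedCorr2 L n a b := by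
  rw [heisStructureFactor_eq_sum_zero_left, sum_torusSite_two_eq_sum_range]
  refine sum_congr rfl fun a _ => sum_congr rfl fun b _ => ?_
  rw [cos_torusPhase_eq_cos_val, heisRedCorr2, cosNat]
  congr 4
  simp only [Fin.sum_univ_two, cons_val_zero, cons_val_one]
  rw [show ((q₁ : ZMod L) * a + q₂ * b) = ((q₁ * a + q₂ * b : ℕ) : ZMod L) by push_cast; ring,
    ZMod.val_natCast]

/-- **The bond correlation on the two-dimensional torus**: `ε = (c(1,0) + c(0,1))/2`.
[cite: KLS1988JSP, eq. (3)] -/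
theorem heisBondCorr_two_eq (L : ℕ) [NeZero L] (n : ℕ) :
    heisBondCorr (d := 2) 0 L n = (heisRedCorr2 L n 1 0 + heisRedCorr2 L n 0 1) / 2 := by
  rw [heisBondCorr_eq_sum_zero_left, Fin.sum_univ_two, heisRedCorr2, heisRedCorr2]
  congr 3
  · ext i; fin_cases i <;> simp
  · ext i; fin_cases i <;> simp

/-- **The reflection-positivity Hankel blocks as explicit finite sums**: for every `j` and every real
`w : Fin k → ℝ`, `0 ≤ Σ_{i,i'<k} w_i w_{i'} Σ_{t<2k} cos(2π(jt mod 2k)/2k) (−c(i+i'+1, t))`.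
[cite: DLS1978, Theorem 4.2] [cite: KLS1988JSP, eqs. (20)–(25)] -/
theorem heis_rpHankelBlock_range (k : ℕ) [NeZero (2 * k)] (n j : ℕ) (w : Fin k → ℝ) :
    0 ≤ ∑ i : Fin k, ∑ i' : Fin k, w i * w i' *
        ∑ t ∈ range (2 * k), cosNat (2 * k) ((j * t) % (2 * k)) *
          -heisRedCorr2 (2 * k) n ((i : ℕ) + i' + 1) t := by
  have h := heis_rpHankelBlock_nonneg k n (j : ZMod (2 * k)) w
  refine h.trans_eq (sum_congr rfl fun i _ => sum_congr rfl fun i' _ => ?_)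
  congr 1
  rw [sum_zmod_eq_sum_range]
  refine sum_congr rfl fun t _ => ?_
  rw [cos_torusPhase_transverse, cosNat, heisRedCorr2, ← Nat.cast_mul, ZMod.val_natCast]
  push_cast
  ring_nf

/-! ### Paired Hankel blocks with a rational relaxation of the odd part

On the `2k`-torus the blocks at transverse momenta `j` and `k - j` have the same even-`t` part and
opposite odd-`t` parts (`cos(2π(k-j)t/2k) = (-1)^t cos(2πjt/2k)`).  When the odd-`t` cosines are
`σ s(t)` with `σ` irrational (e.g. `σ = √2/2` on the `8`-torus, `√3/2` on the `12`-torus) the two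
blocks `Ev ± σ·Od ≥ 0` imply the RATIONAL cuts `Ev ± ρ·Od ≥ 0` for every rational `0 ≤ ρ ≤ σ`. -/

/-- Periodicity of the cosine table. [folklore] -/
private theorem cosNat_mod (L : ℕ) [NeZero L] (m : ℕ) :
    cosNat L (m % L) = Real.cos (2 * Real.pi * (m : ℝ) / (L : ℝ)) := by
  unfold cosNat
  have hL : (L : ℝ) ≠ 0 := by exact_mod_cast NeZero.ne L
  conv_rhs => rw [← Nat.mod_add_div m L, Nat.cast_add, Nat.cast_mul,
    show 2 * Real.pi * ((m % L : ℕ) + (L : ℝ) * (m / L : ℕ)) / (L : ℝ)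
      = 2 * Real.pi * ((m % L : ℕ) : ℝ) / (L : ℝ) + ((m / L : ℕ) : ℝ) * (2 * Real.pi) by
      rw [mul_add, add_div, mul_div_assoc, mul_div_assoc, mul_div_cancel_left₀ _ hL]; ring,
    Real.cos_add_nat_mul_two_pi]

/-- `cos(2π(k-j)t/2k) = (-1)^t cos(2πjt/2k)` for `j ≤ k`. [folklore] -/
private theorem cosNat_compl (k : ℕ) [NeZero (2 * k)] (j t : ℕ) (hj : j ≤ k) :
    cosNat (2 * k) (((k - j) * t) % (2 * k)) = (-1) ^ t * cosNat (2 * k) ((j * t) % (2 * k)) := by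
  rw [cosNat_mod, cosNat_mod]
  have h2k : ((2 * k : ℕ) : ℝ) ≠ 0 := by exact_mod_cast NeZero.ne (2 * k)
  rw [Nat.cast_mul (k - j) t, Nat.cast_sub hj,
    show 2 * Real.pi * (((k : ℝ) - j) * (t : ℝ)) / ((2 * k : ℕ) : ℝ)
      = (t : ℝ) * Real.pi - 2 * Real.pi * ((j * t : ℕ) : ℝ) / ((2 * k : ℕ) : ℝ) from ?_]
  · rw [Real.cos_sub, Real.cos_nat_mul_pi, Real.sin_nat_mul_pi, zero_mul, add_zero]
  · rw [eq_sub_iff_add_eq, ← add_div, div_eq_iff h2k]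
    push_cast
    ring

/-- Linearity of the Hankel quadratic form in the momentum profile. [folklore] -/
private theorem rpBlockForm_congr_add (k n : ℕ) (w : Fin k → ℝ) (φ e o : ℕ → ℝ) (a : ℝ)
    (h : ∀ t ∈ range (2 * k), φ t = e t + a * o t) :
    (∑ i : Fin k, ∑ i' : Fin k, w i * w i' *
        ∑ t ∈ range (2 * k), φ t * -heisRedCorr2 (2 * k) n ((i : ℕ) + i' + 1) t) =
      (∑ i : Fin k, ∑ i' : Fin k, w i * w i' *
        ∑ t ∈ range (2 * k), e t * -heisRedCorr2 (2 * k) n ((i : ℕ) + i' + 1) t) +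
      a * (∑ i : Fin k, ∑ i' : Fin k, w i * w i' *
        ∑ t ∈ range (2 * k), o t * -heisRedCorr2 (2 * k) n ((i : ℕ) + i' + 1) t) := by
  have inner : ∀ i i' : Fin k,
      (∑ t ∈ range (2 * k), φ t * -heisRedCorr2 (2 * k) n ((i : ℕ) + i' + 1) t) =
        (∑ t ∈ range (2 * k), e t * -heisRedCorr2 (2 * k) n ((i : ℕ) + i' + 1) t) +
        a * ∑ t ∈ range (2 * k), o t * -heisRedCorr2 (2 * k) n ((i : ℕ) + i' + 1) t := by
    intro i i'
    rw [mul_sum, ← sum_add_distrib]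
    exact sum_congr rfl fun t ht => by rw [h t ht]; ring
  simp_rw [inner, mul_add, sum_add_distrib, mul_sum]
  congr 1
  exact sum_congr rfl fun i _ => sum_congr rfl fun i' _ => by ring

/-- The elementary relaxation: `0 ≤ Ev ± σ·Od` and `0 ≤ ρ ≤ σ` give `0 ≤ Ev ± ρ·Od`. [folklore] -/
private theorem rp_pair_relax {Ev Od σ ρ : ℝ} (hρ : 0 ≤ ρ) (hρσ : ρ ≤ σ)
    (hp : 0 ≤ Ev + σ * Od) (hm : 0 ≤ Ev - σ * Od) :
    0 ≤ Ev + ρ * Od ∧ 0 ≤ Ev - ρ * Od := by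
  rcases le_total 0 Od with hO | hO
  · have := mul_le_mul_of_nonneg_right hρσ hO
    have := mul_nonneg hρ hO
    constructor <;> linarith
  · have := mul_le_mul_of_nonpos_right hρσ hO
    have := mul_nonpos_of_nonneg_of_nonpos hρ hO
    constructor <;> linarith

/-- **Paired reflection-positivity Hankel blocks, rational relaxation.** On the `2k`-torus let
`0 ≤ j ≤ k` and suppose the odd-`t` cosines at transverse momentum `j` are `cos(2πjt/2k) = σ s(t)`
(`t` odd).  Then for every `0 ≤ ρ ≤ σ` and every real test vector `w`,
`0 ≤ Σ_{i,i'} w_i w_{i'} Σ_t κ±(t) (−c(i+i'+1, t))` with `κ±(t) = cos(2πjt/2k)` for even `t` and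
`κ±(t) = ±ρ s(t)` for odd `t` — the blocks at `j` and `k - j` combined (`Ev ± σ Od ≥ 0 ⇒ Ev ± ρ Od ≥ 0`).
[cite: DLS1978, Theorem 4.2] [cite: KLS1988JSP, eqs. (20)–(25)] -/
theorem heis_rpHankelPair_range (k : ℕ) [NeZero (2 * k)] (n j : ℕ) (hj : j ≤ k) (w : Fin k → ℝ)
    (σ ρ : ℝ) (s : ℕ → ℝ) (hρ : 0 ≤ ρ) (hρσ : ρ ≤ σ)
    (hodd : ∀ t ∈ range (2 * k), ¬ 2 ∣ t → cosNat (2 * k) ((j * t) % (2 * k)) = σ * s t) :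
    (0 ≤ ∑ i : Fin k, ∑ i' : Fin k, w i * w i' * ∑ t ∈ range (2 * k),
        (if 2 ∣ t then cosNat (2 * k) ((j * t) % (2 * k)) else ρ * s t) *
          -heisRedCorr2 (2 * k) n ((i : ℕ) + i' + 1) t) ∧
    (0 ≤ ∑ i : Fin k, ∑ i' : Fin k, w i * w i' * ∑ t ∈ range (2 * k),
        (if 2 ∣ t then cosNat (2 * k) ((j * t) % (2 * k)) else -(ρ * s t)) *
          -heisRedCorr2 (2 * k) n ((i : ℕ) + i' + 1) t) := by
  set e : ℕ → ℝ := fun t => if 2 ∣ t then cosNat (2 * k) ((j * t) % (2 * k)) else 0 with he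
  set o : ℕ → ℝ := fun t => if 2 ∣ t then 0 else s t with ho
  have hsplit : ∀ (a : ℝ), ∀ t ∈ range (2 * k),
      (if 2 ∣ t then cosNat (2 * k) ((j * t) % (2 * k)) else a * s t) = e t + a * o t := by
    intro a t _
    simp only [he, ho]
    split_ifs <;> ring
  have hsplit' : ∀ t ∈ range (2 * k),
      (if 2 ∣ t then cosNat (2 * k) ((j * t) % (2 * k)) else -(ρ * s t)) = e t + (-ρ) * o t := by
    intro t ht
    rw [← hsplit (-ρ) t ht, neg_mul]
  have hj' : ∀ t ∈ range (2 * k), cosNat (2 * k) ((j * t) % (2 * k)) = e t + σ * o t := by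
    intro t ht
    simp only [he, ho]
    split_ifs with h2
    · ring
    · rw [hodd t ht h2]; ring
  have hkj : ∀ t ∈ range (2 * k), cosNat (2 * k) (((k - j) * t) % (2 * k)) = e t + (-σ) * o t := by
    intro t ht
    rw [cosNat_compl k j t hj]
    simp only [he, ho]
    split_ifs with h2
    · rw [(even_iff_two_dvd.mpr h2).neg_one_pow]; ring
    · rw [(Nat.odd_iff.mpr (Nat.two_dvd_ne_zero.mp h2)).neg_one_pow, hodd t ht h2]; ring
  have hp := heis_rpHankelBlock_range k n j w
  have hm := heis_rpHankelBlock_range k n (k - j) w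
  rw [rpBlockForm_congr_add k n w _ e o σ hj'] at hp
  rw [rpBlockForm_congr_add k n w _ e o (-σ) hkj, neg_mul, ← sub_eq_add_neg] at hm
  rw [rpBlockForm_congr_add k n w _ e o ρ (hsplit ρ), rpBlockForm_congr_add k n w _ e o (-ρ) hsplit',
    neg_mul, ← sub_eq_add_neg]
  exact rp_pair_relax hρ hρσ hp hm

/-! ### Hankel collection: the blocks as sums over the `2k - 1` anti-diagonals

`Σ_{i,i'} w_i w_{i'} T(i+i'+1) = Σ_m (Σ_{i+i'+1=m} w_i w_{i'}) T(m)`: a certificate row then expands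
`2k - 1` inner sums instead of `k²`. -/

/-- Hankel reindexing of a quadratic form `Σ_{i,i'} w_i w_{i'} T(i + i' + 1)`. [folklore] -/
private theorem sum_fin_fin_hankel (k : ℕ) (w : Fin k → ℝ) (T : ℕ → ℝ) :
    (∑ i : Fin k, ∑ i' : Fin k, w i * w i' * T ((i : ℕ) + i' + 1)) =
      ∑ m ∈ range (2 * k), (∑ i : Fin k, ∑ i' : Fin k,
        if (i : ℕ) + i' + 1 = m then w i * w i' else 0) * T m := by
  symm
  calc ∑ m ∈ range (2 * k), (∑ i : Fin k, ∑ i' : Fin k,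
          if (i : ℕ) + i' + 1 = m then w i * w i' else 0) * T m
      = ∑ m ∈ range (2 * k), ∑ i : Fin k, ∑ i' : Fin k,
          (if (i : ℕ) + i' + 1 = m then w i * w i' else 0) * T m := by
        refine sum_congr rfl fun m _ => ?_
        rw [sum_mul]
        exact sum_congr rfl fun i _ => sum_mul _ _ _
    _ = ∑ i : Fin k, ∑ i' : Fin k, ∑ m ∈ range (2 * k),
          (if (i : ℕ) + i' + 1 = m then w i * w i' else 0) * T m := by
        rw [sum_comm]
        exact sum_congr rfl fun i _ => sum_comm
    _ = ∑ i : Fin k, ∑ i' : Fin k, w i * w i' * T ((i : ℕ) + i' + 1) := by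
        refine sum_congr rfl fun i _ => sum_congr rfl fun i' _ => ?_
        simp_rw [ite_mul, zero_mul]
        rw [sum_ite_eq, if_pos]
        have hi := i.isLt; have hi' := i'.isLt
        exact mem_range.mpr (by omega)

/-- `heis_rpHankelBlock_range` collected along anti-diagonals. [cite: DLS1978, Theorem 4.2] -/
theorem heis_rpHankelBlock_collected (k : ℕ) [NeZero (2 * k)] (n j : ℕ) (w : Fin k → ℝ) :
    0 ≤ ∑ m ∈ range (2 * k), (∑ i : Fin k, ∑ i' : Fin k,
        if (i : ℕ) + i' + 1 = m then w i * w i' else 0) *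
        ∑ t ∈ range (2 * k), cosNat (2 * k) ((j * t) % (2 * k)) * -heisRedCorr2 (2 * k) n m t := by
  have e := sum_fin_fin_hankel k w
    (fun m => ∑ t ∈ range (2 * k), cosNat (2 * k) ((j * t) % (2 * k)) * -heisRedCorr2 (2 * k) n m t)
  beta_reduce at e
  rw [← e]
  exact heis_rpHankelBlock_range k n j w

/-- `heis_rpHankelPair_range` collected along anti-diagonals. [cite: DLS1978, Theorem 4.2] -/
theorem heis_rpHankelPair_collected (k : ℕ) [NeZero (2 * k)] (n j : ℕ) (hj : j ≤ k) (w : Fin k → ℝ)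
    (σ ρ : ℝ) (s : ℕ → ℝ) (hρ : 0 ≤ ρ) (hρσ : ρ ≤ σ)
    (hodd : ∀ t ∈ range (2 * k), ¬ 2 ∣ t → cosNat (2 * k) ((j * t) % (2 * k)) = σ * s t) :
    (0 ≤ ∑ m ∈ range (2 * k), (∑ i : Fin k, ∑ i' : Fin k,
        if (i : ℕ) + i' + 1 = m then w i * w i' else 0) * ∑ t ∈ range (2 * k),
        (if 2 ∣ t then cosNat (2 * k) ((j * t) % (2 * k)) else ρ * s t) * -heisRedCorr2 (2 * k) n m t) ∧
    (0 ≤ ∑ m ∈ range (2 * k), (∑ i : Fin k, ∑ i' : Fin k,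
        if (i : ℕ) + i' + 1 = m then w i * w i' else 0) * ∑ t ∈ range (2 * k),
        (if 2 ∣ t then cosNat (2 * k) ((j * t) % (2 * k)) else -(ρ * s t)) * -heisRedCorr2 (2 * k) n m t) := by
  have e₁ := sum_fin_fin_hankel k w (fun m => ∑ t ∈ range (2 * k),
    (if 2 ∣ t then cosNat (2 * k) ((j * t) % (2 * k)) else ρ * s t) * -heisRedCorr2 (2 * k) n m t)
  have e₂ := sum_fin_fin_hankel k w (fun m => ∑ t ∈ range (2 * k),
    (if 2 ∣ t then cosNat (2 * k) ((j * t) % (2 * k)) else -(ρ * s t)) * -heisRedCorr2 (2 * k) n m t)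
  beta_reduce at e₁ e₂
  rw [← e₁, ← e₂]
  exact heis_rpHankelPair_range k n j hj w σ ρ s hρ hρσ hodd

end NatBookkeeping

end Literature.MathematicalPhysics.QuantumLattice
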